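import Mathlib.Analysis.SpecialFunctions.Complex.CircleAddChar
import Mathlib.Analysis.SpecialFunctions.Trigonometric.Basic
import Mathlib.NumberTheory.LegendreSymbol.AddCharacter
import Mathlib.Data.ZMod.ValMinAbs
import HarnessLib

/-!
# The Gabber–Galil energy in Fourier space (discrete torus `(ℤ/n)²`)

Second step of the tree's proof that the Margulis–Gabber–Galil graphs on `(ℤ/n)²` (neighbours
`(x±1,y), (x,y±1), (x±y,y), (x,y±x)`) are expanders (J. R. Lee 2013, §2, "using the Fourier transform
to unwrap the torus" — done here on the DISCRETE torus rather than on `ℝ²/ℤ²`): with the standard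
additive character `ψ(j) = e^{2πij/n}` of `ZMod n` and the two-dimensional transform
`F(a,b) = ∑_{x,y} f(x,y) ψ(-(ax+by))`,

* `sum_normSq_ft` — Parseval: `∑ ‖F‖² = n² ∑ f²`; `ft_apply_zero`: `F(0) = ∑ f`;
* `ft_shift₁`, `ft_shift₂` — translations become the multipliers `ψ(a)`, `ψ(b)`;
  `ft_shearT`, `ft_shearS` — the shears `(x,y) ↦ (x+y,y)`, `(x,y+x)` become the dual shears
  `(a,b) ↦ (a, b-a)`, `(a-b, b)` on frequencies;
* `energy_eq` — the edge energy `E(f) = ∑_v Σ_{4 forward maps} (f(Mv) - f(v))²` equals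
  `(1/n²) ∑_z (‖ψ(z₁)-1‖² + ‖ψ(z₂)-1‖²) ‖F z‖² + ‖F(S'z) - F z‖² + ‖F(T'z) - F z‖²`;
* `normSq_ψ_sub_one` — `‖ψ(a) - 1‖² = 2 - 2 cos(2π ā/n)` for the centred representative `ā`;
* `energyF_modulus_le` — passing to the modulus `g = ‖F‖ ≥ 0` (reverse triangle inequality):
  `n² E(f) ≥ ∑_z w(z) g(z)² + (g(S'z) - g z)² + (g(T'z) - g z)²`, with `∑ g² = n² ∑ f²` and
  `g(0) = |∑ f|`.

## References

* J. R. Lee, *On expanders from the action of GL(2,ℤ)*, arXiv:1301.6296 (2013), §2 (proof of Thm. 2.3).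
* S. Hoory, N. Linial, A. Wigderson, *Expander graphs and their applications*, Bull. AMS 43 (2006), §8.2.
-/

noncomputable section

namespace Literature.Computability.Complexity

open Finset Complex

namespace GabberGalil

variable {n : ℕ} [NeZero n]

/-! ### The standard character -/

/-- The standard additive character `ψ(j) = e^{2πij/n}` of `ZMod n`. [cite: Lee2013GL2Z, §2 (χ_{m,n})] -/
def ψ : AddChar (ZMod n) ℂ := ZMod.stdAddChar

/-- `ψ` is unimodular. [folklore] -/
theorem norm_ψ (a : ZMod n) : ‖(ψ a : ℂ)‖ = 1 := by
  unfold ψ; rw [ZMod.stdAddChar_apply]; exact Circle.norm_coe _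

/-- `ψ(a + b) = ψ(a) ψ(b)`. [folklore] -/
theorem ψ_add (a b : ZMod n) : ψ (a + b) = ψ a * ψ b := AddChar.map_add_eq_mul _ _ _

/-- `ψ(0) = 1`. [folklore] -/
theorem ψ_zero : ψ (0 : ZMod n) = 1 := AddChar.map_zero_eq_one _

/-- `ψ(a) ≠ 0`. [folklore] -/
theorem ψ_ne_zero (a : ZMod n) : (ψ a : ℂ) ≠ 0 := fun h => by have := norm_ψ a; rw [h, norm_zero] at this; exact zero_ne_one this

/-- `ψ(-a) = conj ψ(a)`. [folklore] -/
theorem ψ_neg (a : ZMod n) : ψ (-a) = starRingEnd ℂ (ψ a) := by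
  have h1 : ψ (-a) * ψ a = 1 := by rw [← ψ_add, neg_add_cancel, ψ_zero]
  have h2 : starRingEnd ℂ (ψ a) * ψ a = 1 := by
    rw [mul_comm, Complex.mul_conj, Complex.normSq_eq_norm_sq, norm_ψ]; simp
  exact mul_right_cancel₀ (ψ_ne_zero a) (h1.trans h2.symm)

/-- **Orthogonality**: `∑_x ψ(t x) = n [t = 0]`. [cite: Lee2013GL2Z, §2 (orthonormal basis χ_{m,n})] -/
theorem sum_ψ_mul (t : ZMod n) : ∑ x : ZMod n, ψ (t * x) = if t = 0 then (n : ℂ) else 0 := by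
  split_ifs with h
  · simp [h]
  · exact AddChar.sum_eq_zero_of_ne_one (ZMod.isPrimitive_stdAddChar n h)

/-- The value of `ψ` at an integer. [folklore] -/
theorem ψ_intCast (t : ℤ) : ψ (t : ZMod n) = Complex.exp (2 * Real.pi * I * t / n) := by
  unfold ψ; exact ZMod.stdAddChar_coe t

/-- **The multiplier**: `‖ψ(a) - 1‖² = 2 - 2 cos(2π ā / n)` with `ā = valMinAbs a`. [cite: Lee2013GL2Z, §2] -/
theorem normSq_ψ_sub_one (a : ZMod n) :
    ‖(ψ a : ℂ) - 1‖ ^ 2 = 2 - 2 * Real.cos (2 * Real.pi * a.valMinAbs / n) := by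
  have ha : ψ a = Complex.exp (2 * Real.pi * I * a.valMinAbs / n) := by
    rw [← ψ_intCast, ZMod.coe_valMinAbs]
  set θ : ℝ := 2 * Real.pi * a.valMinAbs / n with hθ
  have hexp : ψ a = Complex.exp (θ * I) := by
    rw [ha, hθ]; congr 1; push_cast; ring
  rw [hexp, Complex.sq_norm, Complex.normSq_apply]
  simp only [Complex.sub_re, Complex.sub_im, Complex.one_re, Complex.one_im, Complex.exp_ofReal_mul_I_re,
    Complex.exp_ofReal_mul_I_im, sub_zero]
  nlinarith [Real.sin_sq_add_cos_sq θ]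

/-! ### The two-dimensional transform -/

/-- The phase `ψ(-(a x + b y))`. [cite: Lee2013GL2Z, §2] -/
def phase (z v : ZMod n × ZMod n) : ℂ := ψ (-(z.1 * v.1 + z.2 * v.2))

/-- **The transform** `F(a,b) = ∑_{x,y} f(x,y) ψ(-(ax+by))`. [cite: Lee2013GL2Z, §2 (f̂)] -/
def ft (f : ZMod n × ZMod n → ℝ) (z : ZMod n × ZMod n) : ℂ := ∑ v, (f v : ℂ) * phase z v

/-- `F(0) = ∑ f`. [cite: Lee2013GL2Z, §2 ("f̂(0,0) = ∫ f")] -/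
theorem ft_apply_zero (f : ZMod n × ZMod n → ℝ) : ft f (0, 0) = ((∑ v, f v : ℝ) : ℂ) := by
  unfold ft phase
  push_cast
  exact sum_congr rfl fun v _ => by simp

/-- The transform is additive. [folklore] -/
theorem ft_sub (f g : ZMod n × ZMod n → ℝ) (z : ZMod n × ZMod n) :
    ft (fun v => g v - f v) z = ft g z - ft f z := by
  unfold ft; rw [← sum_sub_distrib]; exact sum_congr rfl fun v _ => by push_cast; ring

/-- The double character sum. [folklore] -/
theorem sum_phase_mul_conj (v v' : ZMod n × ZMod n) :
    ∑ z : ZMod n × ZMod n, phase z v * starRingEnd ℂ (phase z v') = if v = v' then ((n : ℂ) ^ 2) else 0 := by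
  have key : ∀ z : ZMod n × ZMod n, phase z v * starRingEnd ℂ (phase z v') =
      ψ ((v'.1 - v.1) * z.1) * ψ ((v'.2 - v.2) * z.2) := fun z => by
    unfold phase
    rw [← ψ_neg, neg_neg, ← ψ_add, ← ψ_add]
    congr 1; ring
  simp only [key]
  rw [Fintype.sum_prod_type]
  simp only [← mul_sum, ← sum_mul]
  rw [sum_ψ_mul, sum_ψ_mul]
  by_cases h : v = v'
  · subst h; simp [sq]
  · rw [if_neg h]
    have : v'.1 - v.1 ≠ 0 ∨ v'.2 - v.2 ≠ 0 := by
      by_contra hc; push Not at hc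
      exact h (Prod.ext (sub_eq_zero.1 hc.1).symm (sub_eq_zero.1 hc.2).symm)
    rcases this with h1 | h2
    · rw [if_neg h1, zero_mul]
    · rw [if_neg h2, mul_zero]

/-- **Parseval**: `∑_z ‖F z‖² = n² ∑_v f(v)²`. [cite: Lee2013GL2Z, §2 ("the Fourier transform is a linear isometry")] -/
theorem sum_normSq_ft (f : ZMod n × ZMod n → ℝ) : ∑ z, ‖ft f z‖ ^ 2 = (n : ℝ) ^ 2 * ∑ v, f v ^ 2 := by
  -- compute `∑_z F z * conj (F z)` in `ℂ`
  have hC : ∑ z, ft f z * starRingEnd ℂ (ft f z) = (((n : ℝ) ^ 2 * ∑ v, f v ^ 2 : ℝ) : ℂ) := by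
    have e1 : ∀ z, ft f z * starRingEnd ℂ (ft f z) = ∑ v, ∑ v', ((f v * f v' : ℝ) : ℂ) * (phase z v * starRingEnd ℂ (phase z v')) :=
      fun z => by
        unfold ft
        rw [map_sum, sum_mul_sum]
        refine sum_congr rfl fun v _ => sum_congr rfl fun v' _ => ?_
        rw [map_mul, Complex.conj_ofReal]; push_cast; ring
    simp only [e1]
    rw [sum_comm]
    simp only [sum_comm (s := (univ : Finset (ZMod n × ZMod n))) (f := fun z v' => ((f _ * f v' : ℝ) : ℂ) * _)]
    simp only [← mul_sum, sum_phase_mul_conj]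
    push_cast
    simp only [mul_ite, mul_zero, sum_ite_eq, mem_univ, if_true, mul_sum]
    exact sum_congr rfl fun v _ => by ring
  have hre := congrArg Complex.re hC
  rw [Complex.ofReal_re, Complex.re_sum] at hre
  rw [← hre]
  refine sum_congr rfl fun z _ => ?_
  rw [Complex.mul_conj, Complex.ofReal_re, Complex.normSq_eq_norm_sq]

/-! ### Translations and shears -/

/-- Translation in `x` is the multiplier `ψ(a)`. [cite: Lee2013GL2Z, §2 ("S and T, being shift operators, act nicely on the Fourier basis")] -/
theorem ft_shift₁ (f : ZMod n × ZMod n → ℝ) (z : ZMod n × ZMod n) :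
    ft (fun v => f (v.1 + 1, v.2)) z = ψ z.1 * ft f z := by
  unfold ft
  rw [mul_sum]
  -- substitute `u = x + 1`
  refine (Fintype.sum_equiv (Equiv.prodCongr (Equiv.addRight (1 : ZMod n)) (Equiv.refl _)) _ _ fun v => ?_)
  obtain ⟨x, y⟩ := v
  simp only [Equiv.prodCongr_apply, Prod.map_apply, Equiv.coe_addRight, Equiv.coe_refl, id_eq, phase]
  rw [mul_left_comm, ← ψ_add]
  congr 2; ring

/-- Translation in `y` is the multiplier `ψ(b)`. [cite: Lee2013GL2Z, §2] -/
theorem ft_shift₂ (f : ZMod n × ZMod n → ℝ) (z : ZMod n × ZMod n) :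
    ft (fun v => f (v.1, v.2 + 1)) z = ψ z.2 * ft f z := by
  unfold ft
  rw [mul_sum]
  refine (Fintype.sum_equiv (Equiv.prodCongr (Equiv.refl _) (Equiv.addRight (1 : ZMod n))) _ _ fun v => ?_)
  obtain ⟨x, y⟩ := v
  simp only [Equiv.prodCongr_apply, Prod.map_apply, Equiv.coe_addRight, Equiv.coe_refl, id_eq, phase]
  rw [mul_left_comm, ← ψ_add]
  congr 2; ring

/-- The dual shear `S'(a, b) = (a, b - a)` on frequencies. [cite: Lee2013GL2Z, §2 (f̂ ∘ T⁻¹)] -/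
def dS (z : ZMod n × ZMod n) : ZMod n × ZMod n := (z.1, z.2 - z.1)

/-- The dual shear `T'(a, b) = (a - b, b)` on frequencies. [cite: Lee2013GL2Z, §2 (f̂ ∘ S⁻¹)] -/
def dT (z : ZMod n × ZMod n) : ZMod n × ZMod n := (z.1 - z.2, z.2)

/-- **The shear `(x,y) ↦ (x+y, y)` becomes `S'` on frequencies.** [cite: Lee2013GL2Z, §2] -/
theorem ft_shearT (f : ZMod n × ZMod n → ℝ) (z : ZMod n × ZMod n) :
    ft (fun v => f (v.1 + v.2, v.2)) z = ft f (dS z) := by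
  unfold ft
  -- substitute `u = x + y`
  refine Fintype.sum_equiv ⟨fun v => (v.1 + v.2, v.2), fun v => (v.1 - v.2, v.2), fun v => by simp, fun v => by simp⟩ _ _ fun v => ?_
  simp only [Equiv.coe_fn_mk, phase, dS]
  congr 2; ring

/-- **The shear `(x,y) ↦ (x, y+x)` becomes `T'` on frequencies.** [cite: Lee2013GL2Z, §2] -/
theorem ft_shearS (f : ZMod n × ZMod n → ℝ) (z : ZMod n × ZMod n) :
    ft (fun v => f (v.1, v.2 + v.1)) z = ft f (dT z) := by
  unfold ft
  refine Fintype.sum_equiv ⟨fun v => (v.1, v.2 + v.1), fun v => (v.1, v.2 - v.1), fun v => by simp, fun v => by simp⟩ _ _ fun v => ?_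
  simp only [Equiv.coe_fn_mk, phase, dT]
  congr 2; ring

/-! ### The energy identity -/

/-- **The edge energy** of the Gabber–Galil graph (each of the four undirected edge types once):
`E(f) = ∑_v (f(x+1,y)-f)² + (f(x,y+1)-f)² + (f(x+y,y)-f)² + (f(x,y+x)-f)²`. [cite: Lee2013GL2Z, §2 (Rayleigh quotient of G_n)] -/
def energyT (f : ZMod n × ZMod n → ℝ) : ℝ :=
  ∑ v, ((f (v.1 + 1, v.2) - f v) ^ 2 + (f (v.1, v.2 + 1) - f v) ^ 2 + (f (v.1 + v.2, v.2) - f v) ^ 2 + (f (v.1, v.2 + v.1) - f v) ^ 2)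

/-- The multiplier weight `w(z) = ‖ψ(z₁) - 1‖² + ‖ψ(z₂) - 1‖²`. [cite: Lee2013GL2Z, §2] -/
def wt (z : ZMod n × ZMod n) : ℝ := ‖(ψ z.1 : ℂ) - 1‖ ^ 2 + ‖(ψ z.2 : ℂ) - 1‖ ^ 2

/-- **The energy in Fourier space**:
`n² E(f) = ∑_z w(z) ‖F z‖² + ‖F(S'z) - F z‖² + ‖F(T'z) - F z‖²`. [cite: Lee2013GL2Z, §2 (eq. after (4))] -/
theorem energy_eq (f : ZMod n × ZMod n → ℝ) :
    (n : ℝ) ^ 2 * energyT f = ∑ z, (wt z * ‖ft f z‖ ^ 2 + ‖ft f (dS z) - ft f z‖ ^ 2 + ‖ft f (dT z) - ft f z‖ ^ 2) := by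
  unfold energyT
  rw [sum_add_distrib, sum_add_distrib, sum_add_distrib, mul_add, mul_add, mul_add]
  -- each of the four energies through Parseval of a difference
  have h1 := sum_normSq_ft (fun v => f (v.1 + 1, v.2) - f v)
  have h2 := sum_normSq_ft (fun v => f (v.1, v.2 + 1) - f v)
  have h3 := sum_normSq_ft (fun v => f (v.1 + v.2, v.2) - f v)
  have h4 := sum_normSq_ft (fun v => f (v.1, v.2 + v.1) - f v)
  simp only [ft_sub, ft_shift₁, ft_shift₂, ft_shearT, ft_shearS] at h1 h2 h3 h4
  rw [← h1, ← h2, ← h3, ← h4]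
  simp only [wt, ← sum_add_distrib]
  refine sum_congr rfl fun z _ => ?_
  rw [show ψ z.1 * ft f z - ft f z = (ψ z.1 - 1) * ft f z by ring, show ψ z.2 * ft f z - ft f z = (ψ z.2 - 1) * ft f z by ring,
    norm_mul, norm_mul, mul_pow, mul_pow]
  ring

/-! ### Passing to the modulus -/

/-- The modulus `g = ‖F‖`. [cite: Lee2013GL2Z, §2] -/
def modulus (f : ZMod n × ZMod n → ℝ) (z : ZMod n × ZMod n) : ℝ := ‖ft f z‖

/-- The shear energy of the modulus with weights: `N'(g) = ∑_z w g² + (g(S'z) - g z)² + (g(T'z) - g z)²`. [cite: Lee2013GL2Z, §2] -/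
def energyF (g : ZMod n × ZMod n → ℝ) : ℝ := ∑ z, (wt z * g z ^ 2 + (g (dS z) - g z) ^ 2 + (g (dT z) - g z) ^ 2)

/-- `g ≥ 0`. [folklore] -/
theorem modulus_nonneg (f : ZMod n × ZMod n → ℝ) (z : ZMod n × ZMod n) : 0 ≤ modulus f z := norm_nonneg _

/-- `g(0) = |∑ f|`. [cite: Lee2013GL2Z, §2] -/
theorem modulus_zero (f : ZMod n × ZMod n → ℝ) : modulus f (0, 0) = |∑ v, f v| := by
  rw [modulus, ft_apply_zero, Complex.norm_real, Real.norm_eq_abs]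

/-- `∑ g² = n² ∑ f²`. [cite: Lee2013GL2Z, §2] -/
theorem sum_modulus_sq (f : ZMod n × ZMod n → ℝ) : ∑ z, modulus f z ^ 2 = (n : ℝ) ^ 2 * ∑ v, f v ^ 2 := sum_normSq_ft f

/-- Weights are nonnegative. [folklore] -/
theorem wt_nonneg (z : ZMod n × ZMod n) : 0 ≤ wt z := add_nonneg (sq_nonneg _) (sq_nonneg _)

/-- **Passing to the modulus** (reverse triangle inequality): `N'(g) ≤ n² E(f)`. [cite: Lee2013GL2Z, §2] -/
theorem energyF_modulus_le (f : ZMod n × ZMod n → ℝ) : energyF (modulus f) ≤ (n : ℝ) ^ 2 * energyT f := by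
  rw [energy_eq, energyF]
  refine sum_le_sum fun z _ => ?_
  unfold modulus
  have h1 : (‖ft f (dS z)‖ - ‖ft f z‖) ^ 2 ≤ ‖ft f (dS z) - ft f z‖ ^ 2 := by
    have := abs_norm_sub_norm_le (ft f (dS z)) (ft f z)
    calc (‖ft f (dS z)‖ - ‖ft f z‖) ^ 2 = |‖ft f (dS z)‖ - ‖ft f z‖| ^ 2 := (sq_abs _).symm
      _ ≤ ‖ft f (dS z) - ft f z‖ ^ 2 := pow_le_pow_left₀ (abs_nonneg _) this 2
  have h2 : (‖ft f (dT z)‖ - ‖ft f z‖) ^ 2 ≤ ‖ft f (dT z) - ft f z‖ ^ 2 := by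
    have := abs_norm_sub_norm_le (ft f (dT z)) (ft f z)
    calc (‖ft f (dT z)‖ - ‖ft f z‖) ^ 2 = |‖ft f (dT z)‖ - ‖ft f z‖| ^ 2 := (sq_abs _).symm
      _ ≤ ‖ft f (dT z) - ft f z‖ ^ 2 := pow_le_pow_left₀ (abs_nonneg _) this 2
  linarith

end GabberGalil

end Literature.Computability.Complexity

end
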